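import Mathlib.RingTheory.Multiplicity
import Mathlib.Algebra.MvPolynomial.Eval
import Mathlib.Algebra.BigOperators.Group.Finset.Basic
import HarnessLib

/-!
# Roy's small value estimate for `𝔾ₐ × 𝔾ₘ` — exponents of a factorisation into non-associated primes, and descent of the leading constant

Topic `Literature/NumberTheory/Transcendental`. Part of the formalisation of the proof of Roy 2013,
Theorem 1.1 (named fact `roy2013_thm_1_1`, `RoySmallValueEstimates.lean`), seat B. Source: D. Roy,
*A small value estimate for `𝔾ₐ × 𝔾ₘ`*, Mathematika 59 (2013) 333–363 = arXiv:1301.0663, §2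
(p. 6) and §6, proof of Prop. 6.4 (p. 17):

> [...] a factorisation of the form `F(uU^{(D)}) = a U_D(α_1)^{e_1} ⋯ U_D(α_s)^{e_s}` [...] the
> `mD`-cycle of `ℙ^m_ℚ` given by `Z = e_1 Z_1 + ⋯ + e_s Z_s` [...] (the points of `Z(ℂ)` are
> conjugate over `ℚ`) [...] `F(R) = a R(α_1)^{e_1} ⋯ R(α_t)^{e_t}` [...] for some `a ∈ ℂ^×`.

Two pieces of pure algebra used to pass from the factorisation of `Φ(P, Q, ·)` over `ℂ` into
powers of the point forms `R ↦ R(α)` to statements over the number field of the `α`'s and about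
Galois orbits ("the multiplicity `e_α` is constant on conjugates", "`a` lies in the field"):

* `emultiplicity_unit_mul_prod_pow` — in an integral domain, for pairwise non-associated primes
  `ℓ_j` and a unit `u`, the multiplicity of `ℓ_i` in `u ∏ ℓ_j^{e_j}` is `e_i`; hence the
  exponents of such a factorisation are unique (`exponents_unique`) and are permuted along with the
  primes by any ring automorphism fixing the product (`exponent_comp_eq`);
* `exists_C_mul_of_map_eq` — if `F, G ∈ K[r]`, `G ≠ 0`, and `F = a·G` after extension of
  scalars to a field `L ⊇ K` with `a ∈ L`, then `a ∈ K` and `F = a·G` in `K[r]`.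

Everything is proved; no definitions, no named facts.

## References

* [Roy2013] D. Roy, *A small value estimate for 𝔾ₐ × 𝔾ₘ*, Mathematika 59 (2013), 333–363
  (arXiv:1301.0663), §2 (cycles attached to a factorisation of a Chow form) and §6, proof of
  Proposition 6.4.
-/

noncomputable section

open Finset

namespace Literature.NumberTheory.Transcendental

namespace Roy2013

/-! ### Multiplicities in a product of powers of non-associated primes -/

section Exponents

variable {A : Type*} [CommRing A] [IsDomain A]

/-- A prime has finite multiplicity in itself (integral domain). [folklore] -/
theorem finiteMultiplicity_self_of_prime {p : A} (hp : Prime p) : FiniteMultiplicity p p := by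
  refine ⟨1, fun ⟨c, hc⟩ => hp.not_unit ?_⟩
  have h1 : p * 1 = p * (p * c) := by rw [mul_one, ← mul_assoc, ← pow_two]; exact hc
  exact IsUnit.of_mul_eq_one c (mul_left_cancel₀ hp.ne_zero h1).symm

/-- **The multiplicity of `ℓ_i` in `u ∏_j ℓ_j^{e_j}` is `e_i`** for a unit `u` and pairwise
non-associated primes `ℓ_j`. [folklore] -/
theorem emultiplicity_unit_mul_prod_pow {ι : Type*} (s : Finset ι) (ℓ : ι → A) (e : ι → ℕ)
    {u : A} (hu : IsUnit u) (hprime : ∀ j ∈ s, Prime (ℓ j))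
    (hnass : ∀ i ∈ s, ∀ j ∈ s, i ≠ j → ¬Associated (ℓ i) (ℓ j)) {i : ι} (hi : i ∈ s) :
    emultiplicity (ℓ i) (u * ∏ j ∈ s, ℓ j ^ e j) = e i := by
  have hp := hprime i hi
  rw [emultiplicity_mul hp, emultiplicity_of_isUnit_right hp.not_unit hu, zero_add,
    Finset.emultiplicity_prod hp, Finset.sum_eq_single i, emultiplicity_pow hp,
    (finiteMultiplicity_self_of_prime hp).emultiplicity_self, mul_one]
  · intro j hj hji
    rw [emultiplicity_pow hp, emultiplicity_eq_zero.mpr, mul_zero]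
    intro hdvd
    exact hnass i hi j hj (Ne.symm hji) (hp.irreducible.associated_of_dvd (hprime j hj).irreducible
      hdvd)
  · intro h; exact absurd hi h

/-- **Uniqueness of the exponents** of a factorisation `u ∏ ℓ_j^{e_j}` into pairwise
non-associated primes. [folklore] -/
theorem exponents_unique {ι : Type*} (s : Finset ι) (ℓ : ι → A) {e e' : ι → ℕ} {u u' : A}
    (hu : IsUnit u) (hu' : IsUnit u') (hprime : ∀ j ∈ s, Prime (ℓ j))
    (hnass : ∀ i ∈ s, ∀ j ∈ s, i ≠ j → ¬Associated (ℓ i) (ℓ j))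
    (h : u * ∏ j ∈ s, ℓ j ^ e j = u' * ∏ j ∈ s, ℓ j ^ e' j) : ∀ i ∈ s, e i = e' i := by
  intro i hi
  have h1 := emultiplicity_unit_mul_prod_pow s ℓ e hu hprime hnass hi
  rw [h, emultiplicity_unit_mul_prod_pow s ℓ e' hu' hprime hnass hi] at h1
  exact_mod_cast h1.symm

/-- **The exponents follow the primes under a ring automorphism fixing the product**: if `φ`
fixes `F = u ∏ ℓ_j^{e_j}` and maps `ℓ_j` to `ℓ_{π(j)}`, then `e_{π(j)} = e_j` — the multiplicity
of a point of a `ℚ`-cycle is constant along its Galois orbit.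
[cite: Roy2013, §2 ("`Z = e_1 Z_1 + ⋯ + e_s Z_s`", conjugate points)] -/
theorem exponent_comp_eq {ι : Type*} (s : Finset ι) (ℓ : ι → A) (e : ι → ℕ) {u : A}
    (hu : IsUnit u) (hprime : ∀ j ∈ s, Prime (ℓ j))
    (hnass : ∀ i ∈ s, ∀ j ∈ s, i ≠ j → ¬Associated (ℓ i) (ℓ j)) (φ : A ≃+* A) {F : A}
    (hF : F = u * ∏ j ∈ s, ℓ j ^ e j) (hφF : φ F = F) (π : ι → ι) (hπ : ∀ j ∈ s, π j ∈ s)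
    (hφℓ : ∀ j ∈ s, φ (ℓ j) = ℓ (π j)) : ∀ j ∈ s, e (π j) = e j := by
  intro j hj
  have h1 : emultiplicity (ℓ (π j)) F = e (π j) := by
    rw [hF]; exact emultiplicity_unit_mul_prod_pow s ℓ e hu hprime hnass (hπ j hj)
  have h2 : emultiplicity (ℓ (π j)) F = e j := by
    rw [← hφℓ j hj, ← hφF, emultiplicity_map_eq φ, hF]
    exact emultiplicity_unit_mul_prod_pow s ℓ e hu hprime hnass hj
  exact_mod_cast h1.symm.trans h2

end Exponents

/-! ### Descent of the leading constant -/

section Descent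

open MvPolynomial

variable {K L : Type*} [Field K] [Field L] [Algebra K L] {σ : Type*}

/-- **Descent of `F = a·G`**: if `F, G ∈ K[r]`, `G ≠ 0` and `F = a·G` over an extension field
`L` (`a ∈ L`), then `a` comes from `K` and `F = a·G` already over `K`. (With `G` the product of
the point forms, this puts the leading constant of the Chow form / of `Φ(P,Q,·)` in the number
field of the points.) [cite: Roy2013, §6, proof of Prop. 6.4 ("for some `a ∈ ℂ^×`")] -/
theorem exists_C_mul_of_map_eq {F G : MvPolynomial σ K} (hG : G ≠ 0) {a : L}
    (h : MvPolynomial.map (algebraMap K L) F = C a * MvPolynomial.map (algebraMap K L) G) :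
    ∃ a' : K, algebraMap K L a' = a ∧ F = C a' * G := by
  obtain ⟨m, hm⟩ := MvPolynomial.ne_zero_iff.mp hG
  have hcoef := congr_arg (coeff m) h
  rw [coeff_map, coeff_C_mul, coeff_map] at hcoef
  have hGm : algebraMap K L (coeff m G) ≠ 0 :=
    (map_ne_zero_iff _ (algebraMap K L).injective).mpr hm
  have ha : algebraMap K L (coeff m F / coeff m G) = a := by
    rw [map_div₀, hcoef, mul_div_assoc, div_self hGm, mul_one]
  refine ⟨coeff m F / coeff m G, ha, ?_⟩
  apply map_injective (algebraMap K L) (algebraMap K L).injective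
  rw [h, map_mul, map_C, ha]

/-- The leading constant so obtained is non-zero when `a ≠ 0`. [folklore] -/
theorem ne_zero_of_algebraMap_eq {a' : K} {a : L} (h : algebraMap K L a' = a) (ha : a ≠ 0) :
    a' ≠ 0 := by
  rintro rfl; exact ha (by rw [← h, map_zero])

end Descent

end Roy2013

end Literature.NumberTheory.Transcendental
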